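import Summits.AtomisticToContinuum.HydrodynamicLimit.Theses.OneFlightGossipEngine

/-!
# `OneFlightLayeredChaos` (crux stmt-AtomisticToContinuum-14535): the mesh `ρ` is monotone along
# nested meshes — WLOG `ρ ∈ (ρ⋆/2, ρ⋆]`, `ρ⋆ = (√2 π σ²)⁻¹`

Load-bearing analysis of the `∃ ρ ∈ [σ, (√2πσ²)⁻¹]` freedom of the crux (refuter `cdisprove`, gen 2;
`--supports stmt-AtomisticToContinuum-14535`). No definitions: every statement is over the route decl's own
text (the tail of `OneFlightLayeredChaos` from `∀ τ` on, verbatim, with the mesh parameter in place of `ρ`).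

* `coarseCell_natCast_mul` — the torus cells of size `m·r` (`m : ℕ`) are unions of cells of size `r`:
  `coarseCell (m r) x k = coarseCell r x k / m` (`Int.floor_div_natCast`; no sign hypothesis, `m = 0` included).
* `pastSigma_natCast_mul_le` — hence the coarse-past σ-algebra `𝒢` of the crux at mesh `m r` is contained in
  the one at mesh `r` (the generating map factors through a measurable recoding of the cell indices).
* `tail_natCast_mul` — so the crux's tail (everything after `ρ` is fixed) at mesh `ρ` IMPLIES the tail at
  mesh `m ρ`: a coarser NESTED mesh asks for fewer test events `E`. (For non-nested meshes `r < r'` the two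
  σ-algebras are incomparable; only divisibility gives monotonicity.) `m = 0`: the velocity-only past
  (`coarseCell 0 ≡ 0`: exact velocities at the two flight starts + partner) is implied by every mesh.
* `oneFlightLayeredChaos_iff_topOctave` — consequently the crux AS TYPED is equivalent to the same statement
  with `ρ` confined to the top factor-2 window `1/2 < ρ √2 π σ² ≤ 1`: a prover loses nothing by taking cells of
  between half and one mean free path, and a disproof need only treat such meshes. Conversely a refutation of a
  FIXED-mesh form at `ρ⋆` (the line's `RegimeBody`) refutes the crux only along the meshes `ρ⋆/m`, `m ∈ ℕ⁺`.
-/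

noncomputable section

namespace Summit.AtomisticToContinuum.HydrodynamicLimit.Theorems.OneFlightLayeredChaos.Negative

open MeasureTheory Set
open Literature.Analysis.FluidPDE Literature.MathematicalPhysics.KineticTheory
open Summit.AtomisticToContinuum.HydrodynamicLimit.Theses.OneFlightGossipEngine

/-- Cells of size `m · r` are read off cells of size `r`: `⌊y/(m r)⌋ = ⌊y/r⌋ / m`. [folklore] -/
theorem coarseCell_natCast_mul {d : Type*} (m : ℕ) (r : ℝ) (x : UnitAddTorus d) :
    Torus.coarseCell ((m : ℝ) * r) x = fun k => Torus.coarseCell r x k / (m : ℤ) := by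
  funext k
  simp only [Torus.coarseCell]
  rw [mul_comm, ← div_div, Int.floor_div_natCast]

/-- The recoding `c ↦ c / m` of the cell indices of a coarse configuration (positions through cells,
velocities exact) is measurable (cell indices live in a countable discrete space). [folklore] -/
theorem measurable_recode {M : ℕ} (m : ℕ) :
    Measurable (fun f : Fin M → (Fin 3 → ℤ) × V3 => fun k => (fun l => (f k).1 l / (m : ℤ), (f k).2)) := by
  refine measurable_pi_lambda _ fun k => ?_
  refine Measurable.prodMk ?_ ?_
  · exact (Measurable.of_discrete (f := fun c : Fin 3 → ℤ => fun l => c l / (m : ℤ))).comp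
      ((measurable_pi_apply k).fst)
  · exact (measurable_pi_apply k).snd

/-- The recoding on the generating datum `((coarse config at s_i, coarse config at s_j), partner)` is
measurable. [folklore] -/
theorem measurable_recodePast {M : ℕ} (m : ℕ) :
    Measurable (fun p : ((Fin M → (Fin 3 → ℤ) × V3) × (Fin M → (Fin 3 → ℤ) × V3)) × Fin M =>
        (((fun k => (fun l => (p.1.1 k).1 l / (m : ℤ), (p.1.1 k).2)),
          (fun k => (fun l => (p.1.2 k).1 l / (m : ℤ), (p.1.2 k).2))), p.2)) :=
  (((measurable_recode m).comp measurable_fst.fst).prodMk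
    ((measurable_recode m).comp measurable_fst.snd)).prodMk measurable_snd

/-- Coarse-graining a configuration through cells of size `m r` = recoding its coarse-graining through
cells of size `r`. [folklore] -/
theorem coarseConfig_natCast_mul {M : ℕ} (m : ℕ) (r : ℝ) (w : Config M (Fin 3) T3) :
    coarseConfig (Torus.coarseCell ((m : ℝ) * r)) w =
      (fun f : Fin M → (Fin 3 → ℤ) × V3 => fun k => (fun l => (f k).1 l / (m : ℤ), (f k).2)) (coarseConfig (Torus.coarseCell r) w) := by
  funext k
  simp [coarseConfig, coarseCell_natCast_mul]

/-- The generating map of `𝒢` at mesh `m r` factors through the one at mesh `r`. [folklore] -/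
theorem pastGen_natCast_mul {M : ℕ} {ε : ℝ} (Φ : HardSphereFlow (Torus.geometry (Fin 3)) ε M)
    (i : Fin M) (n m : ℕ) (r : ℝ) :
    (fun z => (Φ.coarsePastOf (Torus.coarseCell ((m : ℝ) * r)) i n z, Φ.nthPartnerOf i n z)) =
      (fun p : ((Fin M → (Fin 3 → ℤ) × V3) × (Fin M → (Fin 3 → ℤ) × V3)) × Fin M =>
        (((fun k => (fun l => (p.1.1 k).1 l / (m : ℤ), (p.1.1 k).2)),
          (fun k => (fun l => (p.1.2 k).1 l / (m : ℤ), (p.1.2 k).2))), p.2)) ∘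
        (fun z => (Φ.coarsePastOf (Torus.coarseCell r) i n z, Φ.nthPartnerOf i n z)) := by
  funext z
  simp only [Function.comp_apply, HardSphereFlow.coarsePastOf, coarseConfig_natCast_mul]

/-- **Nested meshes give nested pasts**: the σ-algebra of the coarse past at mesh `m r` is contained
in the one at mesh `r`. [folklore] -/
theorem pastSigma_natCast_mul_le {M : ℕ} {ε : ℝ} (Φ : HardSphereFlow (Torus.geometry (Fin 3)) ε M)
    (i : Fin M) (n m : ℕ) (r : ℝ) :
    MeasurableSpace.comap
        (fun z => (Φ.coarsePastOf (Torus.coarseCell ((m : ℝ) * r)) i n z, Φ.nthPartnerOf i n z))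
        inferInstance ≤
      MeasurableSpace.comap
        (fun z => (Φ.coarsePastOf (Torus.coarseCell r) i n z, Φ.nthPartnerOf i n z)) inferInstance := by
  rw [pastGen_natCast_mul, ← MeasurableSpace.comap_comp]
  exact MeasurableSpace.comap_mono (measurable_recodePast m).comap_le

/-- The route decl IS `∀ a₀ θ₀ > 0 ∃ C p σ₀ ∀ σ ∈ (0,σ₀) ∃ ρ ∈ [σ, (√2πσ²)⁻¹], (tail at mesh ρ)` — the
parenthesised tail being its own text from `∀ τ` on (syntactic identity, recorded so that the next two
theorems visibly speak about the crux). [folklore] -/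
theorem oneFlightLayeredChaos_iff_tail :
    OneFlightLayeredChaos ↔ ∀ (a₀ θ₀ : ℝ), 0 < a₀ → 0 < θ₀ → ∃ C : ℝ, 0 < C ∧ ∃ p : ℝ, 0 < p ∧
      ∃ σ₀ : ℝ, 0 < σ₀ ∧ ∀ σ : ℝ, 0 < σ → σ < σ₀ →
        ∃ ρ : ℝ, σ ≤ ρ ∧ ρ * (Real.sqrt 2 * Real.pi * σ ^ 2) ≤ 1 ∧ (∀ τ : ℝ, 0 < τ → ∀ n : ℕ, ∃ N₀ : ℕ, ∀ N : ℕ, N₀ ≤ N → ∀ Φ : Literature.Analysis.FluidPDE.HardSphereFlow (Literature.Analysis.FluidPDE.Torus.geometry (Fin 3)) (Literature.MathematicalPhysics.KineticTheory.hsDiameter σ N) (N + 1), ∀ (i : Fin (N + 1)) (B : Set Literature.MathematicalPhysics.KineticTheory.V3), MeasurableSet B → let G : Literature.Analysis.FluidPDE.Geometry (Fin 3) Literature.MathematicalPhysics.KineticTheory.T3 := Literature.Analysis.FluidPDE.Torus.geometry (Fin 3); let ε : ℝ := Literature.MathematicalPhysics.KineticTheory.hsDiameter σ N; let w : ℝ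 := τ * ((N + 1 : ℕ) : ℝ) ^ (-(1 / 3 : ℝ)); let q : Literature.MathematicalPhysics.KineticTheory.T3 → (Fin 3 → ℤ) := Literature.Analysis.FluidPDE.Torus.coarseCell (ρ * ((N + 1 : ℕ) : ℝ) ^ (-(1 / 3 : ℝ))); let P : MeasureTheory.Measure (Literature.Analysis.FluidPDE.Config (N + 1) (Fin 3) Literature.MathematicalPhysics.KineticTheory.T3) := Literature.MathematicalPhysics.KineticTheory.localGibbsLaw σ (fun _ => a₀) (fun _ => 0) (fun _ => θ₀) N Φ; let W : Set (Literature.Analysis.FluidPDE.Config (N + 1) (Fin 3) Literature.MathematicalPhysics.KineticTheory.T3) := {z | n + 1 ≤ Set.ncard (Literature.Analysis.FluidPDE.collisionTimesOf G ε (fun t => Φ.flow t z) i ∩ Set.Ioc 0 w)}; let A : Set (Literature.Analysis.FluidPDE.Config (N + 1) (Fin 3) Literature.MathematicalPhysics.KineticTheory.T3) := {z | (Φ.nthRecordOf i n z).outDir ∈ B}; let u : ℝ := (((Literature.MathematicalPhysics.KineticTheory.sphereMeasure (E := Literature.MathematicalPhysics.KineticTheory.V3)) Set.univ)⁻¹ *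 (Literature.MathematicalPhysics.KineticTheory.sphereMeasure (E := Literature.MathematicalPhysics.KineticTheory.V3)) {ω | (ω : Literature.MathematicalPhysics.KineticTheory.V3) ∈ B}).toReal; ∀ E : Set (Literature.Analysis.FluidPDE.Config (N + 1) (Fin 3) Literature.MathematicalPhysics.KineticTheory.T3), MeasurableSet[MeasurableSpace.comap (fun z => (Φ.coarsePastOf q i n z, Φ.nthPartnerOf i n z)) inferInstance] E → |(P (W ∩ A ∩ E)).toReal - u * (P (W ∩ E)).toReal| ≤ C * σ ^ p) :=
  Iff.rfl

/-- **Mesh monotonicity.** The crux's tail at mesh `ρ` implies its tail at every NESTED coarser mesh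
`m ρ`, `m : ℕ` (same `C, p, N₀`): every test event of the coarser past is a test event of the finer past.
`m = 0` is the velocity-only past. [folklore] -/
theorem tail_natCast_mul (a₀ θ₀ C p σ ρ : ℝ) (m : ℕ)
    (h : (∀ τ : ℝ, 0 < τ → ∀ n : ℕ, ∃ N₀ : ℕ, ∀ N : ℕ, N₀ ≤ N → ∀ Φ : Literature.Analysis.FluidPDE.HardSphereFlow (Literature.Analysis.FluidPDE.Torus.geometry (Fin 3)) (Literature.MathematicalPhysics.KineticTheory.hsDiameter σ N) (N + 1), ∀ (i : Fin (N + 1)) (B : Set Literature.MathematicalPhysics.KineticTheory.V3), MeasurableSet B → let G : Literature.Analysis.FluidPDE.Geometry (Fin 3) Literature.MathematicalPhysics.KineticTheory.T3 := Literature.Analysis.FluidPDE.Torus.geometry (Fin 3); let ε : ℝ := Literature.MathematicalPhysics.KineticTheory.hsDiameter σ N; let w : ℝ := τ * ((N + 1 : ℕ) : ℝ) ^ (-(1 / 3 : ℝ)); let q : Literature.MathematicalPhysics.KineticTheory.T3 → (Fin 3 → ℤ) := Literature.Analysis.FluidPDE.Torus.coarseCell (ρ * ((N + 1 : ℕ)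 : ℝ) ^ (-(1 / 3 : ℝ))); let P : MeasureTheory.Measure (Literature.Analysis.FluidPDE.Config (N + 1) (Fin 3) Literature.MathematicalPhysics.KineticTheory.T3) := Literature.MathematicalPhysics.KineticTheory.localGibbsLaw σ (fun _ => a₀) (fun _ => 0) (fun _ => θ₀) N Φ; let W : Set (Literature.Analysis.FluidPDE.Config (N + 1) (Fin 3) Literature.MathematicalPhysics.KineticTheory.T3) := {z | n + 1 ≤ Set.ncard (Literature.Analysis.FluidPDE.collisionTimesOf G ε (fun t => Φ.flow t z) i ∩ Set.Ioc 0 w)}; let A : Set (Literature.Analysis.FluidPDE.Config (N + 1) (Fin 3) Literature.MathematicalPhysics.KineticTheory.T3) := {z | (Φ.nthRecordOf i n z).outDir ∈ B}; let u : ℝ := (((Literature.MathematicalPhysics.KineticTheory.sphereMeasure (E := Literature.MathematicalPhysics.KineticTheory.V3)) Set.univ)⁻¹ * (Literature.MathematicalPhysics.KineticTheory.sphereMeasure (E := Literature.MathematicalPhysics.KineticTheory.V3)) {ω | (ω : Literature.MathematicalPhysics.KineticTheory.V3) ∈ B}).toReal; ∀ E : Set (Literature.Analysis.FluidPDE.Config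 (N + 1) (Fin 3) Literature.MathematicalPhysics.KineticTheory.T3), MeasurableSet[MeasurableSpace.comap (fun z => (Φ.coarsePastOf q i n z, Φ.nthPartnerOf i n z)) inferInstance] E → |(P (W ∩ A ∩ E)).toReal - u * (P (W ∩ E)).toReal| ≤ C * σ ^ p)) :
    (∀ τ : ℝ, 0 < τ → ∀ n : ℕ, ∃ N₀ : ℕ, ∀ N : ℕ, N₀ ≤ N → ∀ Φ : Literature.Analysis.FluidPDE.HardSphereFlow (Literature.Analysis.FluidPDE.Torus.geometry (Fin 3)) (Literature.MathematicalPhysics.KineticTheory.hsDiameter σ N) (N + 1), ∀ (i : Fin (N + 1)) (B : Set Literature.MathematicalPhysics.KineticTheory.V3), MeasurableSet B → let G : Literature.Analysis.FluidPDE.Geometry (Fin 3) Literature.MathematicalPhysics.KineticTheory.T3 := Literature.Analysis.FluidPDE.Torus.geometry (Fin 3); let ε : ℝ := Literature.MathematicalPhysics.KineticTheory.hsDiameter σ N; let w : ℝ := τ * ((N + 1 : ℕ) : ℝ) ^ (-(1 / 3 : ℝ)); let q : Literature.MathematicalPhysics.KineticTheory.T3 → (Fin 3 → ℤ) := Literature.Analysis.FluidPDE.Torus.coarseCell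 ((((m : ℕ) : ℝ) * ρ) * ((N + 1 : ℕ) : ℝ) ^ (-(1 / 3 : ℝ))); let P : MeasureTheory.Measure (Literature.Analysis.FluidPDE.Config (N + 1) (Fin 3) Literature.MathematicalPhysics.KineticTheory.T3) := Literature.MathematicalPhysics.KineticTheory.localGibbsLaw σ (fun _ => a₀) (fun _ => 0) (fun _ => θ₀) N Φ; let W : Set (Literature.Analysis.FluidPDE.Config (N + 1) (Fin 3) Literature.MathematicalPhysics.KineticTheory.T3) := {z | n + 1 ≤ Set.ncard (Literature.Analysis.FluidPDE.collisionTimesOf G ε (fun t => Φ.flow t z) i ∩ Set.Ioc 0 w)}; let A : Set (Literature.Analysis.FluidPDE.Config (N + 1) (Fin 3) Literature.MathematicalPhysics.KineticTheory.T3) := {z | (Φ.nthRecordOf i n z).outDir ∈ B}; let u : ℝ := (((Literature.MathematicalPhysics.KineticTheory.sphereMeasure (E := Literature.MathematicalPhysics.KineticTheory.V3)) Set.univ)⁻¹ * (Literature.MathematicalPhysics.KineticTheory.sphereMeasure (E := Literature.MathematicalPhysics.KineticTheory.V3)) {ω | (ω : Literature.MathematicalPhysics.KineticTheory.V3) ∈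 B}).toReal; ∀ E : Set (Literature.Analysis.FluidPDE.Config (N + 1) (Fin 3) Literature.MathematicalPhysics.KineticTheory.T3), MeasurableSet[MeasurableSpace.comap (fun z => (Φ.coarsePastOf q i n z, Φ.nthPartnerOf i n z)) inferInstance] E → |(P (W ∩ A ∩ E)).toReal - u * (P (W ∩ E)).toReal| ≤ C * σ ^ p) := by
  intro τ hτ n
  obtain ⟨N₀, hN⟩ := h τ hτ n
  refine ⟨N₀, fun N hNN Φ i B hB => ?_⟩
  intro G ε w q P W A u E hE
  have hle := pastSigma_natCast_mul_le Φ i n m (ρ * ((N + 1 : ℕ) : ℝ) ^ (-(1 / 3 : ℝ)))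
  rw [← mul_assoc] at hle
  exact hN N hNN Φ i B hB E (hle E hE)

/-- Arithmetic of the top octave: for `0 < c`, `0 < ρ`, `ρ c ≤ 1`, the integer `m = ⌊(ρ c)⁻¹⌋₊` has
`1 ≤ m`, `m ρ c ≤ 1` and `1/2 < m ρ c`. [folklore] -/
theorem exists_natCast_mul_mem_topOctave {ρ c : ℝ} (hρ : 0 < ρ) (hc : 0 < c) (h1 : ρ * c ≤ 1) :
    ∃ m : ℕ, 1 ≤ m ∧ (m : ℝ) * ρ * c ≤ 1 ∧ 1 < 2 * ((m : ℝ) * ρ * c) := by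
  have hx : 0 < ρ * c := mul_pos hρ hc
  set x : ℝ := ρ * c with hxdef
  refine ⟨⌊x⁻¹⌋₊, ?_, ?_, ?_⟩
  · exact Nat.one_le_floor_iff _ |>.2 (one_le_inv_iff₀.2 ⟨hx, h1⟩)
  · have hfl : (⌊x⁻¹⌋₊ : ℝ) ≤ x⁻¹ := Nat.floor_le (inv_nonneg.2 hx.le)
    calc (⌊x⁻¹⌋₊ : ℝ) * ρ * c = (⌊x⁻¹⌋₊ : ℝ) * x := by rw [hxdef]; ring
      _ ≤ x⁻¹ * x := by gcongr
      _ = 1 := inv_mul_cancel₀ hx.ne'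
  · have hlt : x⁻¹ < (⌊x⁻¹⌋₊ : ℝ) + 1 := Nat.lt_floor_add_one _
    have hm : x⁻¹ - 1 < (⌊x⁻¹⌋₊ : ℝ) := by linarith
    rcases le_or_gt x (1 / 2) with hxh | hxh
    · have h2 : (x⁻¹ - 1) * x < (⌊x⁻¹⌋₊ : ℝ) * x := by gcongr
      have h3 : (x⁻¹ - 1) * x = 1 - x := by field_simp
      calc (1 : ℝ) ≤ 2 * ((x⁻¹ - 1) * x) := by rw [h3]; linarith
        _ < 2 * ((⌊x⁻¹⌋₊ : ℝ) * x) := by linarith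
        _ = 2 * ((⌊x⁻¹⌋₊ : ℝ) * ρ * c) := by rw [hxdef]; ring
    · have hm1 : (1 : ℝ) ≤ (⌊x⁻¹⌋₊ : ℝ) := by
        exact_mod_cast Nat.one_le_floor_iff _ |>.2 (one_le_inv_iff₀.2 ⟨hx, h1⟩)
      calc (1 : ℝ) < 2 * (1 * x) := by linarith
        _ ≤ 2 * ((⌊x⁻¹⌋₊ : ℝ) * x) := by gcongr
        _ = 2 * ((⌊x⁻¹⌋₊ : ℝ) * ρ * c) := by rw [hxdef]; ring

/-- **WLOG the mesh is in the top octave.** The crux AS TYPED is equivalent to the same statement with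
`ρ` confined to `1/2 < ρ √2 π σ² ≤ 1` (cells of between half and one mean free path): from an
admissible `ρ` pass to `⌊(ρ√2πσ²)⁻¹⌋₊ · ρ` by `tail_natCast_mul`. [folklore] -/
theorem oneFlightLayeredChaos_iff_topOctave :
    OneFlightLayeredChaos ↔ ∀ (a₀ θ₀ : ℝ), 0 < a₀ → 0 < θ₀ → ∃ C : ℝ, 0 < C ∧ ∃ p : ℝ, 0 < p ∧
      ∃ σ₀ : ℝ, 0 < σ₀ ∧ ∀ σ : ℝ, 0 < σ → σ < σ₀ →
        ∃ ρ : ℝ, σ ≤ ρ ∧ ρ * (Real.sqrt 2 * Real.pi * σ ^ 2) ≤ 1 ∧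
          1 < 2 * (ρ * (Real.sqrt 2 * Real.pi * σ ^ 2)) ∧ (∀ τ : ℝ, 0 < τ → ∀ n : ℕ, ∃ N₀ : ℕ, ∀ N : ℕ, N₀ ≤ N → ∀ Φ : Literature.Analysis.FluidPDE.HardSphereFlow (Literature.Analysis.FluidPDE.Torus.geometry (Fin 3)) (Literature.MathematicalPhysics.KineticTheory.hsDiameter σ N) (N + 1), ∀ (i : Fin (N + 1)) (B : Set Literature.MathematicalPhysics.KineticTheory.V3), MeasurableSet B → let G : Literature.Analysis.FluidPDE.Geometry (Fin 3) Literature.MathematicalPhysics.KineticTheory.T3 := Literature.Analysis.FluidPDE.Torus.geometry (Fin 3); let ε : ℝ := Literature.MathematicalPhysics.KineticTheory.hsDiameter σ N; let w : ℝ := τ * ((N + 1 : ℕ) : ℝ) ^ (-(1 / 3 : ℝ)); let q : Literature.MathematicalPhysics.KineticTheory.T3 → (Fin 3 → ℤ) := Literature.Analysis.FluidPDE.Torus.coarseCell (ρ * ((N + 1 : ℕ) : ℝ) ^ (-(1 / 3 : ℝ))); let P : MeasureTheory.Measure (Literature.Analysis.FluidPDE.Config (N + 1) (Fin 3) Literature.MathematicalPhysics.KineticTheory.T3)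 := Literature.MathematicalPhysics.KineticTheory.localGibbsLaw σ (fun _ => a₀) (fun _ => 0) (fun _ => θ₀) N Φ; let W : Set (Literature.Analysis.FluidPDE.Config (N + 1) (Fin 3) Literature.MathematicalPhysics.KineticTheory.T3) := {z | n + 1 ≤ Set.ncard (Literature.Analysis.FluidPDE.collisionTimesOf G ε (fun t => Φ.flow t z) i ∩ Set.Ioc 0 w)}; let A : Set (Literature.Analysis.FluidPDE.Config (N + 1) (Fin 3) Literature.MathematicalPhysics.KineticTheory.T3) := {z | (Φ.nthRecordOf i n z).outDir ∈ B}; let u : ℝ := (((Literature.MathematicalPhysics.KineticTheory.sphereMeasure (E := Literature.MathematicalPhysics.KineticTheory.V3)) Set.univ)⁻¹ * (Literature.MathematicalPhysics.KineticTheory.sphereMeasure (E := Literature.MathematicalPhysics.KineticTheory.V3)) {ω | (ω : Literature.MathematicalPhysics.KineticTheory.V3) ∈ B}).toReal; ∀ E : Set (Literature.Analysis.FluidPDE.Config (N + 1) (Fin 3) Literature.MathematicalPhysics.KineticTheory.T3), MeasurableSet[MeasurableSpace.comap (fun z => (Φ.coarsePastOf q i n z, Φ.nthPartnerOf i n z))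 inferInstance] E → |(P (W ∩ A ∩ E)).toReal - u * (P (W ∩ E)).toReal| ≤ C * σ ^ p) := by
  rw [oneFlightLayeredChaos_iff_tail]
  constructor
  · intro h a₀ θ₀ ha hθ
    obtain ⟨C, hC, p, hp, σ₀, hσ₀, hσ⟩ := h a₀ θ₀ ha hθ
    refine ⟨C, hC, p, hp, σ₀, hσ₀, fun σ hs hs₀ => ?_⟩
    obtain ⟨ρ, hσρ, hρ1, hT⟩ := hσ σ hs hs₀
    have hc : 0 < Real.sqrt 2 * Real.pi * σ ^ 2 := by positivity
    have hρ : 0 < ρ := hs.trans_le hσρ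
    obtain ⟨m, hm1, hmle, hmgt⟩ := exists_natCast_mul_mem_topOctave hρ hc hρ1
    refine ⟨(m : ℝ) * ρ, ?_, by simpa [mul_assoc] using hmle, by simpa [mul_assoc] using hmgt,
      tail_natCast_mul a₀ θ₀ C p σ ρ m hT⟩
    have hm1' : (1 : ℝ) ≤ m := by exact_mod_cast hm1
    calc σ ≤ ρ := hσρ
      _ = 1 * ρ := (one_mul ρ).symm
      _ ≤ (m : ℝ) * ρ := by gcongr
  · intro h a₀ θ₀ ha hθ
    obtain ⟨C, hC, p, hp, σ₀, hσ₀, hσ⟩ := h a₀ θ₀ ha hθ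
    refine ⟨C, hC, p, hp, σ₀, hσ₀, fun σ hs hs₀ => ?_⟩
    obtain ⟨ρ, hσρ, hρ1, _, hT⟩ := hσ σ hs hs₀
    exact ⟨ρ, hσρ, hρ1, hT⟩

end Summit.AtomisticToContinuum.HydrodynamicLimit.Theorems.OneFlightLayeredChaos.Negative

end
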